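import Literature.NumberTheory.EllipticCurves.PadicPthPowerCriterionProofs
import Literature.NumberTheory.EllipticCurves.TateJTransport
import Literature.NumberTheory.EllipticCurves.TateCurve.NumberField
import Mathlib.NumberTheory.Padics.HeightOneSpectrum
import HarnessLib

/-!
# The Tate parameter attached to a rational `j`-invariant is a `p`-th power in `ℚ_p` when
# `p ∣ v_p(1/j)` and the unit part `u = j⁻¹ p^{-k}` satisfies `u^{p−1} ≡ 1 (mod p²)` (`p` odd)

`Proofs` file (theorems only: no definition, no named fact) in topic `NumberTheory/EllipticCurves`.
Sources: J. H. Silverman, *Advanced Topics in the Arithmetic of Elliptic Curves*, GTM 151 (1994), Thm. V.3.1 (b)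
and Lemma V.5.1 (PDF pp. 395, 406: `j(q) = 1/q + 744 + 196884q + ⋯`, so `|1/j − q| ≤ |q|²` — the tree's
`norm_inv_tateJ_sub_le`, and `q ↦ j(q)` is injective on the punctured unit disc — the tree's
`existsUnique_tateJ_eq_of_one_lt_norm`); J.-P. Serre, *A Course in Arithmetic*, Ch. II §3.3 (`ℚ_p^× = p^ℤ × V × U₁`,
`U₁^p = U₂` for `p ≠ 2`: an element `p^k u`, `u ∈ ℤ_p^×`, is a `p`-th power iff `p ∣ k` and `u^{p−1} ≡ 1 (mod p²)` —
the tree's `Padic.exists_pow_prime_eq_iff_of_eq_pow_mul`).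

THE POINT. For `j₀ ∈ ℚ` with `j₀⁻¹ = p^k·u`, `v_p(u) = 0`, the Tate parameter `q ∈ ℚ_p` (`|q| < 1`, `j(q) = j₀`)
satisfies `q = j₀⁻¹(1 + O(q))`, so `q/p^k ≡ u (mod p^k)`; since `k ≥ 2` as soon as `p ∣ k` and `k ≥ 1`, the unit part of
`q` is `≡ u (mod p²)` and the `p`-th power criterion for `q` reads on the RATIONAL data: `p ∣ k` and
`u^{p−1} ≡ 1 (mod p²)`. This is the «SPLIT packet» test of the abc-iut R-W window table (W-num-2's W2-POLES with
`p ∣ t`, `u^{p−1} ≡ 1 (p²)`, `k = 2t`): at such a pole the Kummer class of the Tate parameter is trivial and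
`e(K_u/ℚ_p)` has NO wild factor `p` (consumer: `Cor22.ramificationIdx_subThetaField_dvd_split`, hypothesis `hsplit`).

* `exists_pow_prime_eq_of_tateJ_eq_ratCast` — in `ℚ_[p]` (`p ≠ 2`): `q ≠ 0`, `‖q‖ < 1`, `j(q) = j₀` with
  `j₀⁻¹ = p^k u`, `u ≠ 0`, `v_p(u) = 0`, `p ∣ k`, `|u^{p−1} − 1|_p ≤ p^{−2}` ⇒ `∃ x : ℚ_[p], x^p = q`;
* `exists_pow_prime_eq_of_tateJ_eq_adicCompletion_rat` — the same in the completion `ℚ_v` of `ℚ` at the place `v`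
  with `p_v = p` (Mathlib's `Rat.HeightOneSpectrum.adicCompletion.padicEquiv : ℚ_v ≃A[ℚ] ℚ_[p]`, and the transport
  `map_tateJ` of `j(q)` along continuous ring maps), in the `∀ q` shape consumed by
  `Cor22.ramificationIdx_subThetaField_dvd_split` (`F_tpd = ℚ`).

## References
* [SilvermanATAEC1994] J. H. Silverman, *Advanced Topics*, Thm. V.3.1 (b), Lemma V.5.1 (PDF pp. 395, 406).
* [Serre1973] J.-P. Serre, *A Course in Arithmetic*, Ch. II §3.1 Prop. 7, §3.2 Prop. 8, §3.3.
-/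

noncomputable section

open scoped Classical

namespace Literature.NumberTheory.EllipticCurves

/-! ### In `ℚ_p` -/

section Padic

variable {p : ℕ} [hp : Fact p.Prime]

/-- **The Tate parameter of a rational `j` is a `p`-th power in `ℚ_p` under the unit congruence** (`p` odd): if
`q ∈ ℚ_p`, `q ≠ 0`, `‖q‖ < 1`, `j(q) = j₀ ∈ ℚ` with `j₀⁻¹ = p^k·u`, `u ≠ 0`, `v_p(u) = 0`, `p ∣ k` and
`|u^{p−1} − 1|_p ≤ p^{−2}`, then `q = x^p` for some `x ∈ ℚ_p`. Proof: `|j₀⁻¹ − q| ≤ |q|² = p^{−2k}` (Silverman V.3.1 (b),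
`norm_inv_tateJ_sub_le`), so `U = q/p^k ∈ ℤ_p^×` has `|U − u| ≤ p^{−k} ≤ p^{−2}` and `U^{p−1} ≡ u^{p−1} ≡ 1 (mod p²)`;
conclude by Serre II §3.3 (`Padic.exists_pow_prime_eq_iff_of_eq_pow_mul`).
[cite: SilvermanATAEC1994, Thm. V.3.1 (b) and Lemma V.5.1 (PDF pp. 395, 406)] [cite: Serre1973, Ch. II §3.3] -/
theorem exists_pow_prime_eq_of_tateJ_eq_ratCast (hp2 : p ≠ 2) {q : ℚ_[p]} (hq0 : q ≠ 0) (hq : ‖q‖ < 1)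
    {j₀ u : ℚ} {k : ℕ} (hju : j₀⁻¹ = (p : ℚ) ^ k * u) (hu0 : u ≠ 0) (hu : padicValRat p u = 0)
    (hpk : p ∣ k) (hunit : padicNorm p (u ^ (p - 1) - 1) ≤ (p : ℚ) ^ (-2 : ℤ))
    (hqj : tateJ q = (j₀ : ℚ_[p])) : ∃ x : ℚ_[p], x ^ p = q := by
  have hp1 : (1 : ℝ) < p := by exact_mod_cast hp.out.one_lt
  have hp0 : (0 : ℝ) < p := by positivity
  have hpQ : (p : ℚ_[p]) ≠ 0 := by exact_mod_cast hp.out.ne_zero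
  have hpk0 : (p : ℚ_[p]) ^ k ≠ 0 := pow_ne_zero _ hpQ
  -- `‖u‖ = 1`
  have hnu : ‖((u : ℚ) : ℚ_[p])‖ = 1 := by
    rw [Padic.eq_padicNorm, padicNorm.eq_zpow_of_nonzero hu0, hu, neg_zero, zpow_zero, Rat.cast_one]
  -- `J⁻¹ = p^k u` in `ℚ_p`
  have hJ : (tateJ q)⁻¹ = (p : ℚ_[p]) ^ k * (u : ℚ_[p]) := by
    rw [hqj, ← Rat.cast_inv, hju]; push_cast; ring
  -- `‖q‖ = p^{-k}`, hence `1 ≤ k`, `2 ≤ k`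
  have hqn : ‖q‖ = (p : ℝ) ^ (-(k : ℤ)) := by
    have h := norm_tateJ_eq hq
    have h' : ‖(tateJ q)⁻¹‖ = ‖q‖ := by rw [norm_inv, h, inv_inv]
    rw [← h', hJ, norm_mul, Padic.norm_p_pow, hnu, mul_one]
  have hk1 : 1 ≤ k := by
    by_contra h0
    have hk : k = 0 := by omega
    rw [hk, Nat.cast_zero, neg_zero, zpow_zero] at hqn
    exact (lt_irrefl _) (hqn ▸ hq)
  have hk2 : 2 ≤ k := le_trans hp.out.two_le (Nat.le_of_dvd (by omega) hpk)
  -- second order: `‖J⁻¹ − q‖ ≤ ‖q‖²`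
  have h2 := norm_inv_tateJ_sub_le hq
  -- the unit part `U = q / p^k`: `‖U − u‖ ≤ p^{-k} ≤ p^{-2}`
  set U : ℚ_[p] := q * ((p : ℚ_[p]) ^ k)⁻¹ with hUdef
  have hqU : q = (p : ℚ_[p]) ^ k * U := by rw [hUdef]; field_simp
  have hUu : ‖U - (u : ℚ_[p])‖ ≤ (p : ℝ) ^ (-(2 : ℤ)) := by
    have hUu' : U - (u : ℚ_[p]) = (q - (tateJ q)⁻¹) * ((p : ℚ_[p]) ^ k)⁻¹ := by
      rw [hJ, hUdef]; field_simp
    rw [hUu', norm_mul, norm_inv, Padic.norm_p_pow, norm_sub_rev]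
    calc ‖(tateJ q)⁻¹ - q‖ * ((p : ℝ) ^ (-(k : ℤ)))⁻¹ ≤ ‖q‖ * ‖q‖ * ((p : ℝ) ^ (-(k : ℤ)))⁻¹ := by
          gcongr
      _ = (p : ℝ) ^ (-(k : ℤ)) := by
          rw [hqn]; field_simp
      _ ≤ (p : ℝ) ^ (-(2 : ℤ)) := by
          apply zpow_le_zpow_right₀ hp1.le
          omega
  have hlt2 : (p : ℝ) ^ (-(2 : ℤ)) < 1 := zpow_lt_one_of_neg₀ hp1 (by norm_num)
  have hU1 : ‖U‖ = 1 := by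
    have hlt : ‖U - (u : ℚ_[p])‖ < ‖((u : ℚ) : ℚ_[p])‖ := by rw [hnu]; exact hUu.trans_lt hlt2
    have h := IsUltrametricDist.norm_add_eq_max_of_norm_ne_norm hlt.ne
    rw [sub_add_cancel, max_eq_right hlt.le, hnu] at h
    exact h
  -- in `ℤ_p`
  set Uz : ℤ_[p] := ⟨U, hU1.le⟩ with hUz
  set uz : ℤ_[p] := ⟨((u : ℚ) : ℚ_[p]), hnu.le⟩ with huz
  have hUzunit : IsUnit Uz := PadicInt.isUnit_iff.mpr (by rw [PadicInt.norm_def]; exact hU1)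
  have hdvd : (p : ℤ_[p]) ^ 2 ∣ Uz ^ (p - 1) - 1 := by
    rw [← Ideal.mem_span_singleton, ← PadicInt.norm_le_pow_iff_mem_span_pow]
    have hA : ‖Uz ^ (p - 1) - uz ^ (p - 1)‖ ≤ (p : ℝ) ^ (-(2 : ℤ)) := by
      obtain ⟨c, hc⟩ := sub_dvd_pow_sub_pow Uz uz (p - 1)
      rw [hc, norm_mul]
      calc ‖Uz - uz‖ * ‖c‖ ≤ ‖Uz - uz‖ * 1 := by gcongr; exact PadicInt.norm_le_one c
        _ ≤ (p : ℝ) ^ (-(2 : ℤ)) := by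
            rw [mul_one, PadicInt.norm_def, PadicInt.coe_sub]
            exact hUu
    have hB : ‖uz ^ (p - 1) - 1‖ ≤ (p : ℝ) ^ (-(2 : ℤ)) := by
      rw [PadicInt.norm_def, PadicInt.coe_sub, PadicInt.coe_pow, PadicInt.coe_one, huz]
      change ‖((u : ℚ) : ℚ_[p]) ^ (p - 1) - 1‖ ≤ _
      have hcast : ((u : ℚ) : ℚ_[p]) ^ (p - 1) - 1 = (((u ^ (p - 1) - 1 : ℚ)) : ℚ_[p]) := by push_cast; ring
      rw [hcast, Padic.eq_padicNorm]
      have h' : ((padicNorm p (u ^ (p - 1) - 1) : ℚ) : ℝ) ≤ (((p : ℚ) ^ (-2 : ℤ) : ℚ) : ℝ) :=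
        Rat.cast_le.mpr hunit
      simpa only [Rat.cast_zpow, Rat.cast_natCast] using h'
    have he : Uz ^ (p - 1) - 1 = (Uz ^ (p - 1) - uz ^ (p - 1)) + (uz ^ (p - 1) - 1) := by ring
    rw [he]
    exact (IsUltrametricDist.norm_add_le_max _ _).trans (max_le hA hB)
  have hqU' : q = (p : ℚ_[p]) ^ k * (Uz : ℚ_[p]) := hqU
  exact (Padic.exists_pow_prime_eq_iff_of_eq_pow_mul hp2 hUzunit hqU').mpr ⟨hpk, hdvd⟩

end Padic

/-! ### In the completion `ℚ_v` of `ℚ` at a finite place -/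

open NumberField IsDedekindDomain Rat.HeightOneSpectrum

/-- **The same in `ℚ_v`**, the completion of `ℚ` at the finite place `v` with residue characteristic
`p_v ≠ 2`, in the `∀ q` shape of `Cor22.ramificationIdx_subThetaField_dvd_split` (`F_tpd = ℚ`): for `j₀ ∈ ℚ` with
`j₀⁻¹ = p_v^k u`, `u ≠ 0`, `v_{p_v}(u) = 0`, `p_v ∣ k`, `|u^{p_v−1} − 1|_{p_v} ≤ p_v^{−2}`, EVERY `q ∈ ℚ_v` with
`q ≠ 0`, `‖q‖ < 1`, `j(q) = j₀` is a `p_v`-th power in `ℚ_v`. Transport along Mathlib's continuous `ℚ`-algebra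
isomorphism `adicCompletion.padicEquiv v : ℚ_v ≃A[ℚ] ℚ_{p_v}` (`j(ι q) = ι j(q)` by `map_tateJ`; `ι` maps the valuation
ring onto `ℤ_p`, `padicEquiv_bijOn`, so `‖ι q‖ < 1`). [cite: SilvermanATAEC1994, Thm. V.3.1 (b) and Lemma V.5.1 (PDF pp. 395, 406)]
[cite: Serre1973, Ch. II §3.3] -/
theorem exists_pow_prime_eq_of_tateJ_eq_adicCompletion_rat (v : HeightOneSpectrum (𝓞 ℚ))
    (hp2 : natGenerator v ≠ 2) {j₀ u : ℚ} {k : ℕ} (hju : j₀⁻¹ = (natGenerator v : ℚ) ^ k * u) (hu0 : u ≠ 0)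
    (hu : padicValRat (natGenerator v) u = 0) (hpk : natGenerator v ∣ k)
    (hunit : padicNorm (natGenerator v) (u ^ (natGenerator v - 1) - 1) ≤ (natGenerator v : ℚ) ^ (-2 : ℤ))
    (q : v.adicCompletion ℚ) (hq0 : q ≠ 0) (hq : ‖q‖ < 1)
    (hqj : tateJ q = algebraMap ℚ (v.adicCompletion ℚ) j₀) :
    ∃ y : v.adicCompletion ℚ, y ^ natGenerator v = q := by
  set P : Nat.Primes := primesEquiv v with hP
  have hPp : (P : ℕ) = natGenerator v := rfl
  haveI : Fact (P : ℕ).Prime := ⟨P.2⟩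
  set ι := adicCompletion.padicEquiv (R := 𝓞 ℚ) v with hι
  -- `‖ι q‖ < 1`
  have hint : ∀ x : v.adicCompletion ℚ, ‖x‖ ≤ 1 → ‖ι x‖ ≤ 1 := fun x hx => by
    have hx' : x ∈ (v.adicCompletionIntegers ℚ : Set (v.adicCompletion ℚ)) := by
      rw [SetLike.mem_coe, HeightOneSpectrum.mem_adicCompletionIntegers]
      exact Valued.toNormedField.norm_le_one_iff.mp hx
    exact (PadicInt.mem_subring_iff (P : ℕ)).mp ((adicCompletion.padicEquiv_bijOn (R := 𝓞 ℚ) v).mapsTo hx')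
  have hq0' : ι q ≠ 0 := by
    intro h
    exact hq0 (by simpa using congrArg ι.symm h)
  have hq' : ‖ι q‖ < 1 := by
    rcases (hint q hq.le).lt_or_eq with h | h
    · exact h
    · exfalso
      -- `‖(ι q)⁻¹‖ = 1`, so `(ι q)⁻¹ = ι z` with `z` integral, and `q⁻¹ = z` would be integral
      have hinv : ‖(ι q)⁻¹‖ ≤ 1 := by rw [norm_inv, h, inv_one]
      have hmem : (ι q)⁻¹ ∈ (PadicInt.subring (P : ℕ) : Set ℚ_[P]) :=
        (PadicInt.mem_subring_iff (P : ℕ)).mpr hinv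
      obtain ⟨z, hz, hzq⟩ := (adicCompletion.padicEquiv_bijOn (R := 𝓞 ℚ) v).surjOn hmem
      rw [← hι] at hzq
      have hzq' : z = q⁻¹ := by
        have h1 := congrArg ι.symm hzq
        rw [← map_inv₀, ContinuousAlgEquiv.symm_apply_apply, ContinuousAlgEquiv.symm_apply_apply] at h1
        exact h1
      rw [SetLike.mem_coe, HeightOneSpectrum.mem_adicCompletionIntegers, hzq'] at hz
      have h1 : ‖q⁻¹‖ ≤ 1 := Valued.toNormedField.norm_le_one_iff.mpr hz
      rw [norm_inv, inv_le_one₀ (norm_pos_iff.mpr hq0)] at h1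
      exact absurd hq (not_lt.mpr h1)
  -- `j(ι q) = j₀`
  have hqj' : tateJ (ι q) = ((j₀ : ℚ) : ℚ_[P]) := by
    have h := map_tateJ (ι : v.adicCompletion ℚ →+* ℚ_[P]) ι.continuous hq
    rw [hqj] at h
    rw [← eq_ratCast (algebraMap ℚ ℚ_[P]) j₀]
    change tateJ (ι q) = algebraMap ℚ ℚ_[P] j₀
    rw [← ι.commutes j₀]
    exact h.symm
  obtain ⟨x, hx⟩ := exists_pow_prime_eq_of_tateJ_eq_ratCast (p := (P : ℕ)) hp2 hq0' hq' hju hu0 hu hpk hunit hqj'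
  have hx' : x ^ natGenerator v = ι q := hx
  refine ⟨ι.symm x, ?_⟩
  rw [← map_pow, hx', ContinuousAlgEquiv.symm_apply_apply]

end Literature.NumberTheory.EllipticCurves

end
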